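import Literature.AlgebraicGeometry.ShimuraVarieties.UnitaryBallFubiniStudyWeightLaw
import Mathlib.Analysis.Calculus.FDeriv.Bilinear
import HarnessLib

/-!
# The Segre product of projective systems of automorphic forms and the additivity of their Fubini–Study forms

Layer `Literature/AlgebraicGeometry/ShimuraVarieties`, grouping namespace `BallFS`; sequel of
`UnitaryBallAutomorphicFubiniStudyExact`, first half of the Segre road to the weight law `BallFS.fsFormClass_weight_comm`
(`UnitaryBallFubiniStudyWeightLaw`; its discharge is the sequel `UnitaryBallFubiniStudyWeightLawHolds`).  PROVED here
(definitions with bodies + theorems; no named fact, debt 0):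

* `hasMFDerivAt_bilinear` / `mvfderiv_bilinear_apply` — the Leibniz rule `d(B(X, Y))_x v = B(X x, dY_x v) + B(dX_x v, Y x)`
  for a continuous bilinear `B` and maps `X, Y` of a manifold into normed spaces (any scalars; Mathlib's
  `hasFDerivWithinAt_of_bilinear` read in the chart at `x`);
* `BallFS.segreVec a b` — the Segre (Kronecker) product `ℂᴺ⁺¹ × ℂᴺ'⁺¹ → ℂ^{(N+1)(N'+1)}`, `(a ⊗ b)_{(i,j)} = a_i b_j`
  (target indexed by `Fin (N N' + N + N' + 1)` through `segreIdx`), with `⟪a ⊗ b, c ⊗ d⟫ = ⟪a, c⟫ ⟪b, d⟫`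
  (`inner_segreVec`), `‖a ⊗ b‖ = ‖a‖ ‖b‖` (`norm_segreVec`), as a continuous `ℂ`-bilinear map `segreCLM`;
* `BallFS.segre G G'` — the Segre product of two projective systems of automorphic forms on `𝔹²`: holomorphic
  (`mdifferentiable_segre`), of weight `k + k'` (`segre_mem_factorForms`), nowhere zero (`segre_ne_zero`);
* **`BallFS.fsForm_segre`**: `[G ⊗ G']^*ω_FS = [G]^*ω_FS + [G']^*ω_FS` on `Δ\𝔹²` — locally `[G]^*ω_FS = d((G ∘ s)^*α₀)`
  for the Fubini–Study potential `α₀(Z) = Im⟪Z, ·⟫/‖Z‖²`, and `((G ⊗ G') ∘ s)^*α₀ = (G ∘ s)^*α₀ + (G' ∘ s)^*α₀`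
  POINTWISE (`fsPotentialMForm_pullback_segre`: `⟪X ⊗ Y, X ⊗ dY v + dX v ⊗ Y⟫ = ‖X‖² ⟪Y, dY v⟫ + ⟪X, dX v⟫ ‖Y‖²`);
  on classes `[[G ⊗ G']^*ω_FS] = [[G]^*ω_FS] + [[G']^*ω_FS]` (`deRhamCohomology_mk_fsForm_segre`).  Classically:
  `c₁` of a tensor product of line bundles is the sum (`[G ⊗ G']^*𝒪(1) = [G]^*𝒪(1) ⊗ [G']^*𝒪(1)`).

## References

* P. Griffiths, J. Harris, *Principles of Algebraic Geometry* (1978), Ch. 0 §2 (Fubini–Study form and its potential),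
  Ch. 1 §2 (line bundle of a linear system; Segre map; `c₁(L ⊗ L') = c₁(L) + c₁(L')`). [GriffithsHarrisPrinciples1978]
* I. R. Shafarevich, *Basic Algebraic Geometry 2* (Springer 1994), Ch. IX §3.2 (products of automorphic forms add
  weights). [Shafarevich1994]
* C. Voisin, *Hodge Theory and Complex Algebraic Geometry I* (2002), §2.2.1, §3.3.2 Lemma 3.16. [VoisinHodgeI2002]

## Provenance

hodgecm-mathlib cell, typer seat B-typ03, row B3-25 (γ) (director g2 ruling 2026-08-28T05:11:36Z), increment 1.
No named fact, no instance, no notation.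
-/

noncomputable section

open scoped Manifold ContDiff Topology InnerProductSpace ComplexConjugate
open Set Function MulAction Filter Complex
open Literature.Geometry.ComplexHyperbolic
open Literature.Geometry.ComplexHyperbolic.BallModel (U21 Ball)
open Literature.Geometry.Manifold
open Literature.Geometry.Kaehler
open Literature.NumberTheory.Automorphic.AutomorphyFactor

namespace Literature.AlgebraicGeometry.ShimuraVarieties

namespace BallFS

/-! ### A product rule for continuous bilinear maps on manifolds -/

section Bilinear

variable {𝕜 : Type*} [NontriviallyNormedField 𝕜]
  {EN : Type*} [NormedAddCommGroup EN] [NormedSpace 𝕜 EN]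
  {HN : Type*} [TopologicalSpace HN] {IN : ModelWithCorners 𝕜 EN HN}
  {M : Type*} [TopologicalSpace M] [ChartedSpace HN M]
  {W₁ W₂ W₃ : Type*} [NormedAddCommGroup W₁] [NormedSpace 𝕜 W₁] [NormedAddCommGroup W₂] [NormedSpace 𝕜 W₂]
  [NormedAddCommGroup W₃] [NormedSpace 𝕜 W₃]

/-- **Product rule for a continuous bilinear map on a manifold**: if `X`, `Y` have differentials `X'`, `Y'` at
`x`, then `y ↦ B (X y) (Y y)` has differential `v ↦ B (X x) (Y' v) + B (X' v) (Y x)` (Mathlib's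
`ContinuousLinearMap.hasFDerivWithinAt_of_bilinear` for the maps written in the chart at `x`; Leibniz rule).
[cite: VoisinHodgeI2002, §2.2.1] -/
theorem hasMFDerivAt_bilinear (B : W₁ →L[𝕜] W₂ →L[𝕜] W₃) {X : M → W₁} {Y : M → W₂} {x : M}
    {X' : TangentSpace IN x →L[𝕜] W₁} {Y' : TangentSpace IN x →L[𝕜] W₂}
    (hX : HasMFDerivAt IN 𝓘(𝕜, W₁) X x X') (hY : HasMFDerivAt IN 𝓘(𝕜, W₂) Y x Y') :
    HasMFDerivAt IN 𝓘(𝕜, W₃) (fun y ↦ B (X y) (Y y)) x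
      (B.precompR EN (X x) Y' + B.precompL EN X' (Y x)) := by
  refine ⟨?_, ?_⟩
  · exact B.continuous₂.continuousAt.comp (hX.1.prodMk hY.1)
  · have h := B.hasFDerivWithinAt_of_bilinear hX.2 hY.2
    have e1 : writtenInExtChartAt IN 𝓘(𝕜, W₁) x X (extChartAt IN x x) = X x := by
      simp [writtenInExtChartAt]
    have e2 : writtenInExtChartAt IN 𝓘(𝕜, W₂) x Y (extChartAt IN x x) = Y x := by
      simp [writtenInExtChartAt]
    rw [e1, e2] at h
    exact h

/-- The product rule, evaluated (`mvfderiv` form): `d(B(X,Y))_x v = B (X x) (dY_x v) + B (dX_x v) (Y x)`.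
[cite: VoisinHodgeI2002, §2.2.1] -/
theorem mvfderiv_bilinear_apply (B : W₁ →L[𝕜] W₂ →L[𝕜] W₃) {X : M → W₁} {Y : M → W₂} {x : M}
    (hX : MDifferentiableAt IN 𝓘(𝕜, W₁) X x) (hY : MDifferentiableAt IN 𝓘(𝕜, W₂) Y x) (v : TangentSpace IN x) :
    mvfderiv IN (fun y ↦ B (X y) (Y y)) x v =
      B (X x) (mvfderiv IN Y x v) + B (mvfderiv IN X x v) (Y x) := by
  have h := (hasMFDerivAt_bilinear B hX.hasMFDerivAt hY.hasMFDerivAt).mfderiv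
  exact congrArg (fun L : TangentSpace IN x →L[𝕜] TangentSpace 𝓘(𝕜, W₃) (B (X x) (Y x)) ↦
    (show W₃ from L v)) h

/-- `y ↦ B (X y) (Y y)` is differentiable where `X` and `Y` are (Leibniz rule). [cite: VoisinHodgeI2002, §2.2.1] -/
theorem mdifferentiableAt_bilinear (B : W₁ →L[𝕜] W₂ →L[𝕜] W₃) {X : M → W₁} {Y : M → W₂} {x : M}
    (hX : MDifferentiableAt IN 𝓘(𝕜, W₁) X x) (hY : MDifferentiableAt IN 𝓘(𝕜, W₂) Y x) :
    MDifferentiableAt IN 𝓘(𝕜, W₃) (fun y ↦ B (X y) (Y y)) x :=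
  (hasMFDerivAt_bilinear B hX.hasMFDerivAt hY.hasMFDerivAt).mdifferentiableAt

end Bilinear

/-! ### The Segre product on coordinate spaces -/

section SegreVec

variable {N N' : ℕ}

variable (N N') in
/-- The index bijection `Fin (N + 1) × Fin (N' + 1) ≃ Fin (N N' + N + N' + 1)` of the Segre product
(`finProdFinEquiv` followed by the arithmetic `(N + 1)(N' + 1) = N N' + N + N' + 1`, so that the target is again of
the form `Fin (M + 1)`). [cite: GriffithsHarrisPrinciples1978, Ch. 1 §2] -/
def segreIdx : Fin (N + 1) × Fin (N' + 1) ≃ Fin (N * N' + N + N' + 1) :=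
  finProdFinEquiv.trans (finCongr (by ring))

/-- The Segre (Kronecker) product of coordinate vectors: `(a ⊗ b)_{(i, j)} = a_i b_j`, indexed through `segreIdx`.
[cite: GriffithsHarrisPrinciples1978, Ch. 1 §2] -/
def segreVec (a : EuclideanSpace ℂ (Fin (N + 1))) (b : EuclideanSpace ℂ (Fin (N' + 1))) :
    EuclideanSpace ℂ (Fin (N * N' + N + N' + 1)) :=
  (EuclideanSpace.equiv (Fin (N * N' + N + N' + 1)) ℂ).symm
    fun m ↦ a ((segreIdx N N').symm m).1 * b ((segreIdx N N').symm m).2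

/-- Coordinates of the Segre product. [cite: GriffithsHarrisPrinciples1978, Ch. 1 §2] -/
@[simp] theorem segreVec_apply (a : EuclideanSpace ℂ (Fin (N + 1))) (b : EuclideanSpace ℂ (Fin (N' + 1)))
    (m : Fin (N * N' + N + N' + 1)) :
    segreVec a b m = a ((segreIdx N N').symm m).1 * b ((segreIdx N N').symm m).2 := rfl

/-- `⟪a ⊗ b, c ⊗ d⟫ = ⟪a, c⟫ ⟪b, d⟫`. [cite: GriffithsHarrisPrinciples1978, Ch. 1 §2] -/
theorem inner_segreVec (a c : EuclideanSpace ℂ (Fin (N + 1))) (b d : EuclideanSpace ℂ (Fin (N' + 1))) :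
    ⟪segreVec a b, segreVec c d⟫_ℂ = ⟪a, c⟫_ℂ * ⟪b, d⟫_ℂ := by
  simp only [PiLp.inner_apply, segreVec_apply]
  rw [Fintype.sum_equiv (segreIdx N N').symm _
    (fun p : Fin (N + 1) × Fin (N' + 1) ↦ ⟪a p.1 * b p.2, c p.1 * d p.2⟫_ℂ) (fun _ ↦ rfl),
    Fintype.sum_prod_type, Finset.sum_mul_sum]
  refine Finset.sum_congr rfl fun i _ ↦ Finset.sum_congr rfl fun j _ ↦ ?_
  simp only [RCLike.inner_apply, map_mul]
  ring

/-- `‖a ⊗ b‖ = ‖a‖ ‖b‖`. [cite: GriffithsHarrisPrinciples1978, Ch. 1 §2] -/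
theorem norm_segreVec (a : EuclideanSpace ℂ (Fin (N + 1))) (b : EuclideanSpace ℂ (Fin (N' + 1))) :
    ‖segreVec a b‖ = ‖a‖ * ‖b‖ := by
  have h : ‖segreVec a b‖ ^ 2 = (‖a‖ * ‖b‖) ^ 2 := by
    have ha := inner_self_eq_norm_sq_to_K (𝕜 := ℂ) a
    have hb := inner_self_eq_norm_sq_to_K (𝕜 := ℂ) b
    have hs := inner_self_eq_norm_sq_to_K (𝕜 := ℂ) (segreVec a b)
    rw [inner_segreVec, ha, hb] at hs
    rw [mul_pow]
    exact_mod_cast hs.symm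
  exact (sq_eq_sq₀ (norm_nonneg _) (mul_nonneg (norm_nonneg _) (norm_nonneg _))).1 h

/-- The Segre product of non-zero vectors is non-zero. [cite: GriffithsHarrisPrinciples1978, Ch. 1 §2] -/
theorem segreVec_ne_zero {a : EuclideanSpace ℂ (Fin (N + 1))} {b : EuclideanSpace ℂ (Fin (N' + 1))}
    (ha : a ≠ 0) (hb : b ≠ 0) : segreVec a b ≠ 0 := by
  rw [← norm_ne_zero_iff] at ha hb ⊢
  rw [norm_segreVec]
  exact mul_ne_zero ha hb

/-- Scalars pull out of the Segre product: `(s • a) ⊗ (t • b) = (s t) • (a ⊗ b)`.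
[cite: GriffithsHarrisPrinciples1978, Ch. 1 §2] -/
theorem segreVec_smul_smul (s t : ℂ) (a : EuclideanSpace ℂ (Fin (N + 1))) (b : EuclideanSpace ℂ (Fin (N' + 1))) :
    segreVec (s • a) (t • b) = (s * t) • segreVec a b := by
  ext m
  simp only [segreVec_apply, PiLp.smul_apply, smul_eq_mul]
  ring

variable (N N') in
/-- The Segre product as a continuous `ℂ`-bilinear map. [cite: GriffithsHarrisPrinciples1978, Ch. 1 §2] -/
def segreCLM : EuclideanSpace ℂ (Fin (N + 1)) →L[ℂ] EuclideanSpace ℂ (Fin (N' + 1)) →L[ℂ]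
    EuclideanSpace ℂ (Fin (N * N' + N + N' + 1)) :=
  LinearMap.toContinuousLinearMap
    ((LinearMap.toContinuousLinearMap :
        (EuclideanSpace ℂ (Fin (N' + 1)) →ₗ[ℂ] EuclideanSpace ℂ (Fin (N * N' + N + N' + 1))) ≃ₗ[ℂ]
          EuclideanSpace ℂ (Fin (N' + 1)) →L[ℂ] EuclideanSpace ℂ (Fin (N * N' + N + N' + 1))).toLinearMap ∘ₗ
      LinearMap.mk₂ ℂ segreVec
        (fun a a' b ↦ by ext m; simp [add_mul])
        (fun s a b ↦ by ext m; simp [mul_assoc])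
        (fun a b b' ↦ by ext m; simp [mul_add])
        (fun s a b ↦ by ext m; simp [mul_left_comm]))

/-- Unfolding of `segreCLM` (definitional). [cite: GriffithsHarrisPrinciples1978, Ch. 1 §2] -/
@[simp] theorem segreCLM_apply (a : EuclideanSpace ℂ (Fin (N + 1))) (b : EuclideanSpace ℂ (Fin (N' + 1))) :
    segreCLM N N' a b = segreVec a b := rfl

end SegreVec

/-! ### The Segre product of two projective systems of automorphic forms -/

section Segre

open BallForms (canonicalFactor canonicalCocycle canonicalFactor_ne_zero)
open BallDescent (chart mk_mem_chart_source chart_mk_self mk_chart contMDiffAt_chart mdifferentiableAt_chart)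

variable {Δ : Subgroup U21} {N N' k k' : ℕ}
  {G : Ball → EuclideanSpace ℂ (Fin (N + 1))} {G' : Ball → EuclideanSpace ℂ (Fin (N' + 1))}

variable (G G') in
/-- **The Segre product of two systems**: `(G ⊗ G')(z) = G(z) ⊗ G'(z)`. [cite: GriffithsHarrisPrinciples1978, Ch. 1 §2] -/
def segre : Ball → EuclideanSpace ℂ (Fin (N * N' + N + N' + 1)) := fun z ↦ segreVec (G z) (G' z)

/-- Unfolding of `segre` (definitional). [cite: GriffithsHarrisPrinciples1978, Ch. 1 §2] -/
@[simp] theorem segre_apply (z : Ball) : segre G G' z = segreVec (G z) (G' z) := rfl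

/-- The Segre product of holomorphic systems is holomorphic. [cite: Shafarevich1994, Ch. IX §3.2] -/
theorem mdifferentiable_segre (hGh : MDifferentiable 𝓘(ℂ, Fin 2 → ℂ) 𝓘(ℂ, EuclideanSpace ℂ (Fin (N + 1))) G)
    (hGh' : MDifferentiable 𝓘(ℂ, Fin 2 → ℂ) 𝓘(ℂ, EuclideanSpace ℂ (Fin (N' + 1))) G') :
    MDifferentiable 𝓘(ℂ, Fin 2 → ℂ) 𝓘(ℂ, EuclideanSpace ℂ (Fin (N * N' + N + N' + 1))) (segre G G') := fun z ↦
  mdifferentiableAt_bilinear (IN := 𝓘(ℂ, Fin 2 → ℂ)) (segreCLM N N') (hGh z) (hGh' z)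

/-- **The Segre product of systems of weights `k`, `k'` has weight `k + k'`** (`j^k j^{k'} = j^{k+k'}`).
[cite: Shafarevich1994, Ch. IX §3.2] -/
theorem segre_mem_factorForms (hG : G ∈ factorForms Δ (canonicalCocycle (EuclideanSpace ℂ (Fin (N + 1))) k))
    (hG' : G' ∈ factorForms Δ (canonicalCocycle (EuclideanSpace ℂ (Fin (N' + 1))) k')) :
    segre G G' ∈ factorForms Δ (canonicalCocycle (EuclideanSpace ℂ (Fin (N * N' + N + N' + 1))) (k + k')) := by
  intro δ hδ z
  rw [BallForms.canonicalCocycle_apply, segre_apply, segre_apply, (mem_factorForms_iff.1 hG) δ hδ z,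
    (mem_factorForms_iff.1 hG') δ hδ z, BallForms.canonicalCocycle_apply, BallForms.canonicalCocycle_apply,
    segreVec_smul_smul, pow_add]

/-- The Segre product of nowhere-zero systems is nowhere zero. [cite: GriffithsHarrisPrinciples1978, Ch. 1 §2] -/
theorem segre_ne_zero (h0 : ∀ z, G z ≠ 0) (h0' : ∀ z, G' z ≠ 0) (z : Ball) : segre G G' z ≠ 0 :=
  segreVec_ne_zero (h0 z) (h0' z)

variable [ProperlyDiscontinuousSMul Δ Ball] [IsCancelSMul Δ Ball]

/-- **Additivity of the pulled-back Fubini–Study potential under the Segre product** (pointwise, through a local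
section `s_p` of `𝔹² → Δ\𝔹²`): `((G ⊗ G') ∘ s_p)^*α₀ = (G ∘ s_p)^*α₀ + (G' ∘ s_p)^*α₀` at the points of the source of
`s_p` — `d(X ⊗ Y) v = X ⊗ dY v + dX v ⊗ Y`, `⟪X ⊗ Y, X ⊗ dY v + dX v ⊗ Y⟫ = ‖X‖² ⟪Y, dY v⟫ + ⟪X, dX v⟫ ‖Y‖²` and
`‖X ⊗ Y‖ = ‖X‖ ‖Y‖`. [cite: GriffithsHarrisPrinciples1978, Ch. 0 §2 and Ch. 1 §2] -/
theorem fsPotentialMForm_pullback_segre (hGh : MDifferentiable 𝓘(ℂ, Fin 2 → ℂ) 𝓘(ℂ, EuclideanSpace ℂ (Fin (N + 1))) G)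
    (hGh' : MDifferentiable 𝓘(ℂ, Fin 2 → ℂ) 𝓘(ℂ, EuclideanSpace ℂ (Fin (N' + 1))) G')
    (h0 : ∀ z, G z ≠ 0) (h0' : ∀ z, G' z ≠ 0) {p : Ball} {y : orbitRel.Quotient Δ Ball} (hy : y ∈ (chart Δ p).source) :
    (fsPotentialMForm (W := EuclideanSpace ℂ (Fin (N * N' + N + N' + 1)))).pullback 𝓘(ℝ, Fin 2 → ℂ)
        (segre G G' ∘ chart Δ p) y =
      (fsPotentialMForm (W := EuclideanSpace ℂ (Fin (N + 1)))).pullback 𝓘(ℝ, Fin 2 → ℂ) (G ∘ chart Δ p) y +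
        (fsPotentialMForm (W := EuclideanSpace ℂ (Fin (N' + 1)))).pullback 𝓘(ℝ, Fin 2 → ℂ) (G' ∘ chart Δ p) y := by
  have hX := mdifferentiableAt_real_comp_chart hGh hy
  have hY := mdifferentiableAt_real_comp_chart hGh' hy
  have hcomp : (segre G G' ∘ chart Δ p) = fun y' ↦
      ((segreCLM N N').bilinearRestrictScalars ℝ) ((G ∘ chart Δ p) y') ((G' ∘ chart Δ p) y') := rfl
  ext v
  rw [ContinuousAlternatingMap.add_apply, fsPotentialMForm_pullback_apply, fsPotentialMForm_pullback_apply,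
    fsPotentialMForm_pullback_apply, hcomp, mvfderiv_bilinear_apply _ hX hY]
  simp only [ContinuousLinearMap.bilinearRestrictScalars_apply_apply, segreCLM_apply, Function.comp_apply]
  set X := G (chart Δ p y)
  set Y := G' (chart Δ p y)
  set dX := mvfderiv 𝓘(ℝ, Fin 2 → ℂ) (G ∘ chart Δ p) y (v 0)
  set dY := mvfderiv 𝓘(ℝ, Fin 2 → ℂ) (G' ∘ chart Δ p) y (v 0)
  have hX0 : ‖X‖ ≠ 0 := norm_ne_zero_iff.2 (h0 _)
  have hY0 : ‖Y‖ ≠ 0 := norm_ne_zero_iff.2 (h0' _)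
  have hXXim : (⟪X, X⟫_ℂ).im = 0 := by rw [← RCLike.im_to_complex]; exact inner_self_im X
  have hYYim : (⟪Y, Y⟫_ℂ).im = 0 := by rw [← RCLike.im_to_complex]; exact inner_self_im Y
  have hXXre : (⟪X, X⟫_ℂ).re = ‖X‖ ^ 2 := by rw [← RCLike.re_to_complex]; exact inner_self_eq_norm_sq X
  have hYYre : (⟪Y, Y⟫_ℂ).re = ‖Y‖ ^ 2 := by rw [← RCLike.re_to_complex]; exact inner_self_eq_norm_sq Y
  rw [inner_add_right, inner_segreVec, inner_segreVec, norm_segreVec, Complex.add_im, Complex.mul_im,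
    Complex.mul_im, hXXim, hXXre, hYYim, hYYre]
  field_simp
  ring

/-- **The Fubini–Study form of a Segre product is the sum of the Fubini–Study forms**:
`[G ⊗ G']^*ω_FS = [G]^*ω_FS + [G']^*ω_FS` on `Δ\𝔹²` (locally `[G]^*ω_FS = d((G ∘ s_p)^*α₀)` and the potentials add).
[cite: GriffithsHarrisPrinciples1978, Ch. 0 §2 and Ch. 1 §2] -/
theorem fsForm_segre (hGh : MDifferentiable 𝓘(ℂ, Fin 2 → ℂ) 𝓘(ℂ, EuclideanSpace ℂ (Fin (N + 1))) G)
    (hG : G ∈ factorForms Δ (canonicalCocycle (EuclideanSpace ℂ (Fin (N + 1))) k)) (h0 : ∀ z, G z ≠ 0)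
    (hGh' : MDifferentiable 𝓘(ℂ, Fin 2 → ℂ) 𝓘(ℂ, EuclideanSpace ℂ (Fin (N' + 1))) G')
    (hG' : G' ∈ factorForms Δ (canonicalCocycle (EuclideanSpace ℂ (Fin (N' + 1))) k')) (h0' : ∀ z, G' z ≠ 0) :
    fsForm (segre G G') (segre_mem_factorForms hG hG') (segre_ne_zero h0 h0') =
      fsForm G hG h0 + fsForm G' hG' h0' := by
  funext y
  have hy := mem_chart_out_source (Δ := Δ) y
  set p := Quotient.out y
  have hSh := mdifferentiable_segre hGh hGh'
  set pbS := (fsPotentialMForm (W := EuclideanSpace ℂ (Fin (N * N' + N + N' + 1)))).pullback 𝓘(ℝ, Fin 2 → ℂ)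
    (segre G G' ∘ chart Δ p) with hpbS
  set pb₁ := (fsPotentialMForm (W := EuclideanSpace ℂ (Fin (N + 1)))).pullback 𝓘(ℝ, Fin 2 → ℂ) (G ∘ chart Δ p)
    with hpb₁
  set pb₂ := (fsPotentialMForm (W := EuclideanSpace ℂ (Fin (N' + 1)))).pullback 𝓘(ℝ, Fin 2 → ℂ) (G' ∘ chart Δ p)
    with hpb₂
  have hs₁ : pb₁.SmoothAt y := smoothAt_pullback_potential hGh hy h0
  have hs₂ : pb₂.SmoothAt y := smoothAt_pullback_potential hGh' hy h0'
  have hev : ∀ᶠ y' in 𝓝 y, pbS y' = (pb₁ + pb₂) y' := by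
    filter_upwards [(chart Δ p).open_source.mem_nhds hy] with y' hy'
    exact fsPotentialMForm_pullback_segre hGh hGh' h0 h0' hy'
  rw [Pi.add_apply, fsForm_eq_fsPullback_chart hSh _ _ hy, fsForm_eq_fsPullback_chart hGh hG h0 hy,
    fsForm_eq_fsPullback_chart hGh' hG' h0' hy, ← mextDeriv_pullback_potential hSh hy (segre_ne_zero h0 h0'),
    ← mextDeriv_pullback_potential hGh hy h0, ← mextDeriv_pullback_potential hGh' hy h0',
    mextDeriv_congr_of_eventuallyEq hev, mextDeriv_add_apply hs₁ hs₂]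

/-- … hence on de Rham classes `[[G ⊗ G']^*ω_FS] = [[G]^*ω_FS] + [[G']^*ω_FS]`. [cite: GriffithsHarrisPrinciples1978, Ch. 1 §2] -/
theorem deRhamCohomology_mk_fsForm_segre
    (hGh : MDifferentiable 𝓘(ℂ, Fin 2 → ℂ) 𝓘(ℂ, EuclideanSpace ℂ (Fin (N + 1))) G)
    (hG : G ∈ factorForms Δ (canonicalCocycle (EuclideanSpace ℂ (Fin (N + 1))) k)) (h0 : ∀ z, G z ≠ 0)
    (hGh' : MDifferentiable 𝓘(ℂ, Fin 2 → ℂ) 𝓘(ℂ, EuclideanSpace ℂ (Fin (N' + 1))) G')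
    (hG' : G' ∈ factorForms Δ (canonicalCocycle (EuclideanSpace ℂ (Fin (N' + 1))) k')) (h0' : ∀ z, G' z ≠ 0) :
    deRhamCohomology.mk ⟨fsForm (segre G G') (segre_mem_factorForms hG hG') (segre_ne_zero h0 h0'),
        fsForm_mem_closedSmoothForms (mdifferentiable_segre hGh hGh') _ _⟩ =
      deRhamCohomology.mk ⟨fsForm G hG h0, fsForm_mem_closedSmoothForms hGh hG h0⟩ +
        deRhamCohomology.mk ⟨fsForm G' hG' h0', fsForm_mem_closedSmoothForms hGh' hG' h0'⟩ := by
  rw [← map_add]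
  congr 1
  exact Subtype.ext (fsForm_segre hGh hG h0 hGh' hG' h0')

end Segre

end BallFS

end Literature.AlgebraicGeometry.ShimuraVarieties

end
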